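import Mathlib.Algebra.MvPolynomial.PDeriv
import Mathlib.LinearAlgebra.Matrix.Determinant.Basic
import Mathlib.SetTheory.Cardinal.Continuum
import Mathlib.FieldTheory.IsAlgClosed.Basic
import Mathlib.ModelTheory.Definability
import Mathlib.RingTheory.Algebraic.Basic
import Mathlib.RingTheory.Algebraic.Integral
import Literature.NumberTheory.Transcendental.ExpVarieties
import Literature.ModelTheory.ExponentialFields.ExponentialField
import Literature.ModelTheory.ExponentialFields.ModelTheoryPreds
import HarnessLib
import HarnessLib.Audit

-- provenance: harness21/H21/H21/Prelude/TranscendKaehlerL/ZilberField.lean @ 89e2818 (interim HEAD d8f2665); M5 mechanical rewrite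
/-!
# Zilber fields: the axioms of pseudo-exponentiation (trunk TranscendKaehlerL, C5)

This file provides the *exponential half* of the vocabulary of Zilber's axioms for
pseudo-exponential fields and bundles the axioms into the `Prop`-valued structure
`Literature.IsZilberField K` (notion `zilber_pseudoexponentiation`), together with isomorphisms of
exponential rings (`Literature.NumberTheory.Transcendental.ExponentialRingEquiv`, notion `exponential_field`) and the model-theoretic
predicate of quasiminimality (`FirstOrder.Language.IsQuasiminimal`).

## Contents

* `Literature.expPDeriv j f`: the formal partial derivative `∂/∂Xⱼ` of `f(X, e^X)` for a polynomial
  `f ∈ K[X, Y]` (chain rule: `∂ⱼ f + Yⱼ ∂_{n+j} f`).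
* `Literature.ecl A`: the exponential-algebraic closure of `A ⊆ K` (Kirby 2010, Def. 1.1): coordinates
  of solutions of Khovanskii systems `fᵢ(x, eˣ) = 0` (`i < n`) with nonvanishing Jacobian and
  coefficients in the subring generated by `A`.
* `Literature.HasCountableClosureProperty K` (CCP), `Literature.HasStandardKernel K` (`ker exp = τℤ` with `τ`
  transcendental), `Literature.IsExpAlgClosed K` (EAC), `Literature.IsStronglyExpAlgClosed K` (SEAC).
* `Literature.IsZilberField K`: Zilber's axioms ACF₀ + standard kernel + surjectivity of `exp` onto `Kˣ`
  + Schanuel property + strong exponential-algebraic closedness + CCP (Zilber 2005 §1;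
  Kirby 2013; Bays–Kirby 2018 §1).
* `Literature.ExponentialRingEquiv R S`: E-ring isomorphisms, with `EquivLike`/`RingEquivClass`
  instances, `toExponentialRingHom`, `refl`, `symm`, `trans`.
* `FirstOrder.Language.IsQuasiminimal L M`: every parametrically definable subset of `M` is
  countable or co-countable.
* Named facts (`def … : Prop`, CONVENTIONS §4; no `_holds` yet): Zilber's categoricity and
  existence theorems (`zilber_categoricity`, `exists_isZilberField_of_aleph0_lt`), quasiminimality
  of Zilber fields (`IsZilberField.isQuasiminimal`), and the facts about `ℂ`:
  `hasStandardKernel_complex_of_transcendental_pi` (proved) and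
  `hasCountableClosureProperty_complex` (Zilber 2005 Lemma 5.12).
* The registered OPEN CONJECTURE `IsZilberField.of_isExpAlgClosed` (EAC in place of SEAC modulo
  the other axioms; docstring `OPEN CONJECTURE — … [status: open]`, CONVENTIONS §4): posed as an
  open question in Kirby 2013 §2.3, a theorem under CIT by Kirby–Zilber 2014 Thm 1.5 (in tree:
  `IsZilberField.of_isExpAlgClosed_of_cit`, `IntersectionsWithTori.lean`), unconditionally known
  only in the generic version (Bays–Kirby 2018 Prop. 11.5). It is an open statement, not
  literature debt: no `_holds` theorem is to be expected; the name is kept because it has users.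
* Kirby's linear-independence scheme `Literature.IsLinIndepExpAlgClosed K` (Kirby 2013 §2.3), the proved
  easy directions `IsStronglyExpAlgClosed.isLinIndepExpAlgClosed` and
  `IsLinIndepExpAlgClosed.isExpAlgClosed` (SEAC ⇒ scheme ⇒ EAC), the named fact
  `kirby2013_isStronglyExpAlgClosed_iff_isLinIndepExpAlgClosed` (Kirby 2013 §2.3, Proposition:
  modulo axioms 1–3, SEAC ⇔ the scheme) and its corollary
  `IsZilberField.of_isLinIndepExpAlgClosed`.

## Mathlib search

Mathlib (this pin) has `MvPolynomial.pderiv`, `MvPolynomial.eval`, `Matrix.det`, `Set.Countable`,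
`AddSubgroup.zmultiples`, `IsAlgClosed` (with the instance `Complex.isAlgClosed`),
`Transcendental`, `IsAlgebraic.mul`, `IsAlgebraic.of_pow`, `Cardinal.mk`, `RingEquiv`,
`RingEquivClass`, `Set.Definable₁`. It has no exponential rings, no pseudo-exponentiation
vocabulary and no quasiminimality (`rg -i 'quasiminimal|Zilber|Khovanskii'` is empty), so these
are defined here. Surjectivity of `Complex.exp` onto `ℂˣ` is
`Literature.ModelTheory.ExponentialFields.ExponentialRing.isSurjectiveOntoUnits_complex` and algebraic closedness of `ℂ` is Mathlib's
`Complex.isAlgClosed`; neither is restated here.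

## Design choices

* All axioms are honest `Prop`-valued definitions over `[Field K] [CharZero K] [ExponentialRing K]`
  (the class `Literature.ModelTheory.ExponentialFields.ExponentialRing` of `Languages.lean`); `IsZilberField` is a `structure … : Prop`
  bundling them (a hypothesis structure, not a class: `ℂ` being a Zilber field is a conjecture).
* Points of `Kⁿ × (Kˣ)ⁿ` are `z : Fin n ⊕ Fin n → K` as in `ExpVarieties.lean`; Khovanskii systems
  are `n` polynomials in `MvPolynomial (Fin n ⊕ Fin n) K` evaluated at `Sum.elim x (exp ∘ x)`.
* In EAC/SEAC subvarieties of `Gⁿ = Kⁿ × (Kˣ)ⁿ` (closed in `Gⁿ`, not necessarily in `K^{2n}`)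
  are presented as `W ∩ torusLocus K n` with `W` irreducible Zariski closed in `K^{2n}`;
  rotundity and freeness are asked of `W ∩ torusLocus K n`, dimension, field of definition and
  genericity of `W` (its closure).
* In SEAC the "finitely generated field of definition" `F₀` and the finite parameter set `A` are
  `Finset K`s, and the fields are `Subfield.closure`; genericity is `Literature.NumberTheory.Transcendental.IsGenericOver` (same ideal
  over the subfield).
* `ExponentialRingEquiv` extends `RingEquiv` (Mathlib bundled style, like `AlgEquiv`), with the
  extra field `map_exp'` stated via `toFun` and restated as the `simp` lemma `map_exp`.
* `FirstOrder.Language.IsQuasiminimal` is a deliberate dot-notation extension in Mathlib's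
  namespace `FirstOrder.Language`, declared after `end Literature` (precedent:
  `FirstOrder.Language.IsOMinimal` in `ModelTheoryPreds.lean`), so that one writes
  `Language.expRing.IsQuasiminimal K` and the statements layer can identify Zilber's
  quasiminimality conjecture with `Language.expRing.IsQuasiminimal ℂ` by `Iff.rfl`.
* `zilber_categoricity` and `exists_isZilberField_of_aleph0_lt` quantify over `Type` (universe 0)
  so that cardinal hypotheses are stated in `Cardinal.{0}` without lifts.
* The `Prop`-valued *predicates* of this file (`HasCountableClosureProperty`, `HasStandardKernel`,
  `IsExpAlgClosed`, `IsStronglyExpAlgClosed`, `IsZilberField`, `IsZilberField.of_isExpAlgClosed`,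
  `IsLinIndepExpAlgClosed`, `FirstOrder.Language.IsQuasiminimal`) bind the structure they speak
  about (`K`, resp. `L` and `M`) explicitly in the `def` header rather than through section
  `variable`s: they are properties a structure may or may not have (e.g. `(ℝ, ≤)` is not
  quasiminimal and `ℝ_exp` has no standard kernel, `ZilberFieldProofs.lean`), not closed named
  facts, and none of them has an unconditional `_holds` discharge; among them
  `IsZilberField.of_isExpAlgClosed` is moreover a registered open conjecture (Kirby 2013 §2.3).
  The closed named facts of this file are `zilber_categoricity`,
  `exists_isZilberField_of_aleph0_lt`, `hasCountableClosureProperty_complex`,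
  `IsZilberField.isQuasiminimal` and
  `kirby2013_isStronglyExpAlgClosed_iff_isLinIndepExpAlgClosed` (a statement about every `K`).

## References

* B. Zilber, *Pseudo-exponentiation on algebraically closed fields of characteristic zero*,
  Ann. Pure Appl. Logic 132 (2005), Thms 1.1–1.2, §5 (Lemma 5.12).
* J. Kirby, *Exponential algebraicity in exponential fields*, Bull. LMS 42 (2010), Def. 1.1,
  Thm 1.3.
* J. Kirby, *A note on the axioms for Zilber's pseudo-exponential fields*, Notre Dame J. Formal
  Logic 54 (2013), 509–520 (arXiv:1006.0894), §2.3.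
* J. Kirby, B. Zilber, *Exponentially closed fields and the conjecture on intersections with
  tori*, Ann. Pure Appl. Logic 165 (2014), 1680–1706 (arXiv:1108.1075), Thm 1.5 (= Thm 5.7; arXiv v2 = published
  numbering): "Assuming CIT, a model of axioms 1, 2′, 3′ satisfies SEAC iff it satisfies EAC".
* M. Bays, J. Kirby, *Pseudo-exponential maps, variants, and quasiminimality*, Algebra & Number
  Theory 12 (2018) 493–549 (arXiv:1512.04262), Thm 1.1; §1.2 and §11.1, Prop. 11.5 (generic
  Γ-closedness over a closed base is equivalent to generic strong Γ-closedness, unconditionally).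
* D. Marker, *A remark on Zilber's pseudoexponentiation*, J. Symb. Logic 71 (2006).
-/

noncomputable section

open MvPolynomial Cardinal
open FirstOrder

namespace Literature.NumberTheory.Transcendental

/-! ### Khovanskii systems and the exponential-algebraic closure -/

section Ecl

variable {K : Type*} [Field K] {n : ℕ}

/-- The formal partial derivative with respect to `Xⱼ` of the exponential polynomial
`f(X₁,…,Xₙ, e^{X₁},…,e^{Xₙ})`, for `f ∈ K[X, Y]` (`X = inl`, `Y = inr` variables), expressed again
as a polynomial in `(X, Y)` by the chain rule: `∂f/∂Xⱼ + Yⱼ · ∂f/∂Yⱼ`.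
Kirby 2010, Def. 1.1 (Khovanskii systems). [cite: Kirby2010, Def. 1.1 (Khovanskii systems] -/
def expPDeriv (j : Fin n) (f : MvPolynomial (Fin n ⊕ Fin n) K) : MvPolynomial (Fin n ⊕ Fin n) K :=
  pderiv (Sum.inl j) f + X (Sum.inr j) * pderiv (Sum.inr j) f

/-- Every Zariski closed subset of `K^ι` (`ι` finite) is defined over a finitely generated
subfield: by Hilbert's basis theorem its ideal is generated by finitely many polynomials, which
have coefficients in the subfield generated by their (finitely many) coefficients
(`MvPolynomial.mem_range_map_iff_coeffs_subset`). Marker 2006 §1. [cite: Marker2006, §1] -/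
theorem IsZariskiClosed.exists_isDefinedOver {ι : Type*} [Finite ι] {V : Set (ι → K)}
    (hV : IsZariskiClosed K V) :
    ∃ F₀ : Finset K, IsDefinedOver (Subfield.closure (↑F₀ : Set K)) V := by
  classical
  obtain ⟨I, rfl⟩ := hV
  obtain ⟨s, rfl⟩ := (inferInstance : IsNoetherianRing (MvPolynomial ι K)).noetherian I
  set F : Subfield K := Subfield.closure (↑(s.biUnion coeffs) : Set K)
  have hlift : ∀ p ∈ s, ∃ q : MvPolynomial ι F, map (algebraMap F K) q = p := by
    intro p hp
    show p ∈ Set.range (map (algebraMap F K))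
    rw [mem_range_map_iff_coeffs_subset]
    intro c hc
    exact ⟨⟨c, Subfield.subset_closure
      (Finset.mem_coe.mpr (Finset.mem_biUnion.mpr ⟨p, hp, hc⟩))⟩, rfl⟩
  choose q hq using hlift
  refine ⟨s.biUnion coeffs, Ideal.span (Set.range fun p : s => q p.1 p.2), ?_⟩
  ext x
  rw [zeroLocus_span, zeroLocus_span]
  simp only [Set.mem_setOf_eq, Set.forall_mem_range, Subtype.forall, Finset.mem_coe]
  refine forall₂_congr fun p hp => ?_
  conv_lhs => rw [← hq p hp, aeval_map_algebraMap]

variable [Literature.ModelTheory.ExponentialFields.ExponentialRing K]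

/-- The *exponential-algebraic closure* `ecl A` of a subset `A` of an exponential field `K`
(Kirby 2010, Def. 1.1; Zilber 2005 §5): the set of coordinates `xᵢ` of solutions
`x ∈ Kⁿ` of *Khovanskii systems* over `A`, i.e. systems `f₁(x, eˣ) = ⋯ = fₙ(x, eˣ) = 0` of `n`
exponential polynomial equations with coefficients in the subring generated by `A` whose
Jacobian `det (∂fᵢ/∂xⱼ)(x, eˣ)` does not vanish.

Kirby's Def. 1.1 allows arbitrary (iterated) exponential polynomials `fᵢ`; the form used here,
ordinary polynomials in `(x, eˣ)` (extra variables absorb iterated exponentials, e.g.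
`e^{eˣ}` becomes `e^{x₂}` together with the equation `x₂ - e^{x₁} = 0`), is Kirby's equivalent
reformulation (Kirby 2010, §3, proof of Thm 1.1). The coefficient condition is stated
coefficientwise (`(f i).coeff m ∈ Subring.closure A`); equivalently
`f i ∈ Set.range (map (Subring.closure A).subtype)` by
`MvPolynomial.mem_range_map_iff_coeffs_subset`. [cite: Kirby2010, Def. 1.1] -/
def ecl (A : Set K) : Set K :=
  {a | ∃ (n : ℕ) (x : Fin n → K) (f : Fin n → MvPolynomial (Fin n ⊕ Fin n) K),
    (∃ i, x i = a) ∧ (∀ i m, (f i).coeff m ∈ Subring.closure A) ∧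
    (∀ i, eval (Sum.elim x (Literature.ModelTheory.ExponentialFields.ExponentialRing.exp ∘ x)) (f i) = 0) ∧
    (Matrix.of fun i j => eval (Sum.elim x (Literature.ModelTheory.ExponentialFields.ExponentialRing.exp ∘ x)) (expPDeriv j (f i))).det ≠ 0}

/-- `ecl` is monotone: enlarging the parameter set enlarges the subring of admissible
coefficients. Kirby 2010, Lemma 3.3 (`ecl` is a closure operator). [cite: Kirby2010, Lemma 3.3 ( ecl  is a closure operator] -/
theorem ecl_mono {A B : Set K} (h : A ⊆ B) : ecl A ⊆ ecl B := by
  rintro a ⟨n, x, f, hx, hcoeff, heval, hdet⟩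
  exact ⟨n, x, f, hx, fun i m => Subring.closure_mono h (hcoeff i m), heval, hdet⟩

/-- Every element lies in its own exponential-algebraic closure: `a` solves the one-variable
Khovanskii system `X - a = 0` (Jacobian `1`). Kirby 2010, Lemma 3.3. [cite: Kirby2010, Lemma 3.3] -/
theorem subset_ecl (A : Set K) : A ⊆ ecl A := by
  classical
  intro a ha
  refine ⟨1, fun _ => a, fun _ => X (Sum.inl 0) - C a, ⟨0, rfl⟩, ?_, ?_, ?_⟩
  · intro i m
    rw [coeff_sub, coeff_X, coeff_C]
    refine sub_mem ?_ ?_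
    · split_ifs
      exacts [one_mem _, zero_mem _]
    · split_ifs
      exacts [Subring.subset_closure ha, zero_mem _]
  · intro i
    simp
  · have : ∀ j : Fin 1, eval (Sum.elim (fun _ => a) (Literature.ModelTheory.ExponentialFields.ExponentialRing.exp ∘ fun _ => a))
        (expPDeriv j (X (Sum.inl 0) - C a) : MvPolynomial (Fin 1 ⊕ Fin 1) K) = 1 := by
      intro j
      simp [expPDeriv, Subsingleton.elim j 0, pderiv_X]
    rw [Matrix.det_unique, Matrix.of_apply, this]
    exact one_ne_zero

/-- The *countable closure property* (CCP) of an exponential field: the exponential-algebraic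
closure of a countable set is countable. Zilber 2005 §1 (axiom CCP) and §5; Kirby 2010,
Thm 1.3.

Zilber phrases CCP for *finite* parameter sets (`ecl A` countable for `A` finite); the countable
form used here is equivalent because `ecl` is a closure operator of finite character
(Kirby 2010, Lemma 3.3 and Thm 1.1: `ecl A = ⋃ {ecl A₀ | A₀ ⊆ A finite}`), so the closure of a
countable set is a countable union of closures of finite sets. [cite: Kirby2010, Lemma 3.3 and Thm 1.1:  ecl A = ⋃ {ecl A] -/
def HasCountableClosureProperty (K : Type*) [Field K]
    [Literature.ModelTheory.ExponentialFields.ExponentialRing K] : Prop :=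
  ∀ A : Set K, A.Countable → (ecl A).Countable

end Ecl

/-! ### The axioms -/

section Axioms

/-- An exponential field has *standard kernel* if `ker exp = τℤ` is infinite cyclic, generated by
an element `τ` transcendental over `ℚ` (Zilber 2005 §1, axiom "ker = ωℤ, ω transcendental";
Kirby 2013 §2, axiom 2). For `ℂ_exp`, `τ = 2πi`. [cite: Zilber2005, §1  axiom "ker = ωℤ  ω transcendental"] -/
def HasStandardKernel (K : Type*) [Field K] [CharZero K]
    [Literature.ModelTheory.ExponentialFields.ExponentialRing K] : Prop :=
  ∃ τ : K, Transcendental ℚ τ ∧ Literature.ModelTheory.ExponentialFields.ExponentialRing.expKernel K = AddSubgroup.zmultiples τ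

/-- *Exponential-algebraic closedness* (EAC; Zilber 2005 §1, axiom (EC); Kirby 2013 §2): every
irreducible subvariety `V` of `Gⁿ = Kⁿ × (Kˣ)ⁿ` of dimension `n` which is rotund and additively
and multiplicatively free meets the graph of exponentiation.

Subvarieties of `Gⁿ` (closed *in `Gⁿ`*, not in `K^{2n}`) are presented as `V = W ∩ Gⁿ` with `W`
an irreducible Zariski closed subset of `K^{2n}` meeting `Gⁿ = torusLocus K n`; since `Gⁿ` is
Zariski open, `W ∩ Gⁿ` is dense in `W`, so `W` is the closure of `V` and `dim V = zariskiDim K W`.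
(Quantifying only over closed `V ⊆ torusLocus` would lose e.g. `{y = x} ∩ G¹`.) The conclusion
`(W ∩ expGraph).Nonempty` equals `(V ∩ expGraph).Nonempty` by `expGraph_subset_torusLocus`. [cite: Zilber2005, §1  axiom (EC] -/
def IsExpAlgClosed (K : Type*) [Field K]
    [Literature.ModelTheory.ExponentialFields.ExponentialRing K] : Prop :=
  ∀ (n : ℕ) (W : Set (Fin n ⊕ Fin n → K)), IsIrreducibleClosed K W →
    (W ∩ torusLocus K n).Nonempty → IsRotund K n (W ∩ torusLocus K n) →
    IsAddFree K n (W ∩ torusLocus K n) → IsMulFree K n (W ∩ torusLocus K n) →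
    zariskiDim K W = n → (W ∩ expGraph K n).Nonempty

/-- *Strong exponential-algebraic closedness* (SEAC; Zilber 2005 §1, axiom (SEC); Kirby 2013,
§2, fifth axiom): for every irreducible rotund, additively and multiplicatively free subvariety
`V = W ∩ Gⁿ` of `Gⁿ = Kⁿ × (Kˣ)ⁿ` of dimension `n` (presented by its Zariski closure `W` in
`K^{2n}`, as in `IsExpAlgClosed`) defined over a finitely generated subfield `ℚ(F₀)`, and every
finite `A ⊆ K`, there is a point `(x, eˣ) ∈ V` which is generic in `V` over `ℚ(A ∪ F₀)`.
Since `V` is dense in the irreducible `W`, "defined over" and "generic in `V`" are the same as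
for `W` (same ideal), which is how they are stated. [cite: Zilber2005, §1  axiom (SEC] -/
def IsStronglyExpAlgClosed (K : Type*) [Field K]
    [Literature.ModelTheory.ExponentialFields.ExponentialRing K] : Prop :=
  ∀ (n : ℕ) (W : Set (Fin n ⊕ Fin n → K)), IsIrreducibleClosed K W →
    (W ∩ torusLocus K n).Nonempty → IsRotund K n (W ∩ torusLocus K n) →
    IsAddFree K n (W ∩ torusLocus K n) → IsMulFree K n (W ∩ torusLocus K n) →
    zariskiDim K W = n →
    ∀ (A : Finset K) (F₀ : Finset K), IsDefinedOver (Subfield.closure (↑F₀ : Set K)) W →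
      ∃ z ∈ W ∩ expGraph K n, IsGenericOver (Subfield.closure (↑A ∪ ↑F₀ : Set K)) W z

/-- **Zilber fields** (fields with pseudo-exponentiation; Zilber 2005 §1; Kirby 2013 §2;
Bays–Kirby 2018 §1). An exponential field `K` of characteristic zero *is a Zilber field* if it
satisfies Zilber's axioms: `K` is algebraically closed, `ker exp = τℤ` with `τ` transcendental,
`exp : K → Kˣ` is surjective, the Schanuel property holds, `K` is strongly
exponentially-algebraically closed, and `K` has the countable closure property. [cite: Zilber2005, §1] -/
structure IsZilberField (K : Type*) [Field K] [CharZero K]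
    [Literature.ModelTheory.ExponentialFields.ExponentialRing K] : Prop where
  /-- `K` is algebraically closed (ACF₀ together with `[CharZero K]`). -/
  isAlgClosed : IsAlgClosed K
  /-- The kernel of `exp` is `τℤ` with `τ` transcendental. -/
  hasStandardKernel : HasStandardKernel K
  /-- Every nonzero element is an exponential. -/
  isSurjectiveOntoUnits : Literature.ModelTheory.ExponentialFields.ExponentialRing.IsSurjectiveOntoUnits K
  /-- The Schanuel property. -/
  schanuelProperty : Literature.ModelTheory.ExponentialFields.SchanuelProperty K
  /-- Strong exponential-algebraic closedness. -/
  isStronglyExpAlgClosed : IsStronglyExpAlgClosed K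
  /-- The countable closure property. -/
  hasCountableClosureProperty : HasCountableClosureProperty K

end Axioms

section EAC

variable {K : Type*} [Field K] [Literature.ModelTheory.ExponentialFields.ExponentialRing K]

/-- Strong exponential-algebraic closedness implies exponential-algebraic closedness: every
Zariski closed `W ⊆ K^{2n}` is defined over a finitely generated subfield
(`IsZariskiClosed.exists_isDefinedOver`), and SEAC (with `A = ∅`) then produces a point of
`W ∩ expGraph`. Kirby 2013 §2. [cite: Kirby2013, §2] -/
theorem IsStronglyExpAlgClosed.isExpAlgClosed (h : IsStronglyExpAlgClosed K) :
    IsExpAlgClosed K := by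
  intro n W hirr hne hrot hadd hmul hdim
  obtain ⟨F₀, hF₀⟩ := hirr.1.exists_isDefinedOver
  obtain ⟨z, hz, -⟩ := h n W hirr hne hrot hadd hmul hdim ∅ F₀ hF₀
  exact ⟨z, hz⟩

end EAC

/-! ### Isomorphisms of exponential rings -/

/-- An *isomorphism of exponential rings* (E-ring isomorphism; van den Dries 1984 §1, Kirby 2013
§2): a ring isomorphism `e : R ≃+* S` with `e (exp x) = exp (e x)` for all `x`. These are the
isomorphisms in Zilber's categoricity theorem (Zilber 2005, Thm 1.1). [cite: Dries1984, §1  Kirby 2013 §2] -/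
structure ExponentialRingEquiv (R S : Type*) [Ring R] [Ring S] [Literature.ModelTheory.ExponentialFields.ExponentialRing R]
    [Literature.ModelTheory.ExponentialFields.ExponentialRing S] extends R ≃+* S where
  /-- An E-ring isomorphism commutes with the exponential maps. -/
  map_exp' : ∀ x, toFun (Literature.ModelTheory.ExponentialFields.ExponentialRing.exp x) = Literature.ModelTheory.ExponentialFields.ExponentialRing.exp (toFun x)

namespace ExponentialRingEquiv

variable {R S T : Type*} [Ring R] [Ring S] [Ring T] [Literature.ModelTheory.ExponentialFields.ExponentialRing R] [Literature.ModelTheory.ExponentialFields.ExponentialRing S]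
  [Literature.ModelTheory.ExponentialFields.ExponentialRing T]

/-- E-ring isomorphisms are equivalences (Mathlib `EquivLike` boilerplate). [folklore] -/
instance instEquivLike : EquivLike (ExponentialRingEquiv R S) R S where
  coe f := f.toFun
  inv f := f.invFun
  left_inv f := f.left_inv
  right_inv f := f.right_inv
  coe_injective' f g h₁ h₂ := by
    obtain ⟨⟨⟨f, _⟩, _⟩, _⟩ := f
    obtain ⟨⟨⟨g, _⟩, _⟩, _⟩ := g
    congr

/-- E-ring isomorphisms are ring isomorphisms (Mathlib `RingEquivClass` boilerplate). [folklore] -/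
instance instRingEquivClass : RingEquivClass (ExponentialRingEquiv R S) R S where
  map_add f := f.map_add'
  map_mul f := f.map_mul'

/-- The coercion of an E-ring isomorphism to a function is that of its underlying ring
isomorphism. [folklore] -/
@[simp] theorem coe_toRingEquiv (e : ExponentialRingEquiv R S) : ⇑e.toRingEquiv = e := rfl

/-- An E-ring isomorphism commutes with `exp` (van den Dries 1984 §1). [cite: Dries1984, §1] -/
@[simp] theorem map_exp (e : ExponentialRingEquiv R S) (x : R) :
    e (Literature.ModelTheory.ExponentialFields.ExponentialRing.exp x) = Literature.ModelTheory.ExponentialFields.ExponentialRing.exp (e x) :=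
  e.map_exp' x

/-- Two E-ring isomorphisms are equal if they agree pointwise. [folklore] -/
@[ext] theorem ext {e f : ExponentialRingEquiv R S} (h : ∀ x, e x = f x) : e = f :=
  DFunLike.ext e f h

/-- The underlying E-ring morphism of an E-ring isomorphism (van den Dries 1984 §1). [cite: Dries1984, §1] -/
def toExponentialRingHom (e : ExponentialRingEquiv R S) : Literature.ModelTheory.ExponentialFields.ExponentialRingHom R S where
  toRingHom := e.toRingEquiv.toRingHom
  map_exp' := e.map_exp'

/-- `toExponentialRingHom` is the same function. [folklore] -/
@[simp] theorem toExponentialRingHom_apply (e : ExponentialRingEquiv R S) (x : R) :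
    e.toExponentialRingHom x = e x := rfl

variable (R) in
/-- The identity E-ring isomorphism. [folklore] -/
protected def refl : ExponentialRingEquiv R R where
  toRingEquiv := RingEquiv.refl R
  map_exp' _ := rfl

/-- The identity E-ring isomorphism is the identity function. [folklore] -/
@[simp] theorem refl_apply (x : R) : ExponentialRingEquiv.refl R x = x := rfl

/-- The inverse of an E-ring isomorphism is an E-ring isomorphism (E-rings form a category whose
isomorphisms are the bijective morphisms; van den Dries 1984 §1). [cite: Dries1984, §1] -/
protected def symm (e : ExponentialRingEquiv R S) : ExponentialRingEquiv S R where
  toRingEquiv := e.toRingEquiv.symm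
  map_exp' y := by
    change e.toRingEquiv.symm (Literature.ModelTheory.ExponentialFields.ExponentialRing.exp y) = Literature.ModelTheory.ExponentialFields.ExponentialRing.exp (e.toRingEquiv.symm y)
    apply e.toRingEquiv.injective
    rw [RingEquiv.apply_symm_apply, coe_toRingEquiv, map_exp, ← coe_toRingEquiv,
      RingEquiv.apply_symm_apply]

/-- `e.symm` is a left inverse of `e`. [folklore] -/
@[simp] theorem symm_apply_apply (e : ExponentialRingEquiv R S) (x : R) : e.symm (e x) = x :=
  e.toRingEquiv.symm_apply_apply x

/-- `e.symm` is a right inverse of `e`. [folklore] -/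
@[simp] theorem apply_symm_apply (e : ExponentialRingEquiv R S) (y : S) : e (e.symm y) = y :=
  e.toRingEquiv.apply_symm_apply y

/-- Composition of E-ring isomorphisms (diagrammatic order, as `RingEquiv.trans`). [folklore] -/
protected def trans (e : ExponentialRingEquiv R S) (f : ExponentialRingEquiv S T) :
    ExponentialRingEquiv R T where
  toRingEquiv := e.toRingEquiv.trans f.toRingEquiv
  map_exp' x := by
    change f (e (Literature.ModelTheory.ExponentialFields.ExponentialRing.exp x)) = Literature.ModelTheory.ExponentialFields.ExponentialRing.exp (f (e x))
    rw [map_exp, map_exp]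

/-- Unfolding lemma for `trans`. [folklore] -/
@[simp] theorem trans_apply (e : ExponentialRingEquiv R S) (f : ExponentialRingEquiv S T)
    (x : R) : e.trans f x = f (e x) := rfl

end ExponentialRingEquiv

/-! ### Zilber's theorems -/

section Theorems

/-- **Zilber's categoricity theorem** (Zilber 2005, Thm 1.1; complete proof in Bays–Kirby 2018,
Thm 1.1): two Zilber fields of the same uncountable cardinality are isomorphic as exponential
fields. Stated for fields in `Type` so that the cardinals live in `Cardinal.{0}`. [cite: Zilber2005, Thm 1.1] -/
def zilber_categoricity : Prop :=
  ∀ {K K' : Type} [Field K] [CharZero K] [Literature.ModelTheory.ExponentialFields.ExponentialRing K] [Field K'] [CharZero K'] [Literature.ModelTheory.ExponentialFields.ExponentialRing K'] (hK : IsZilberField K) (hK' : IsZilberField K') (hcard : #K = #K') (hunc : ℵ₀ < #K),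
    Nonempty (ExponentialRingEquiv K K')

/-- **Zilber's existence theorem** (Zilber 2005, Thm 1.1; Bays–Kirby 2018, Thm 1.1): for every
uncountable cardinal `κ` there is a Zilber field of cardinality `κ`. [cite: Zilber2005, Thm 1.1] -/
def exists_isZilberField_of_aleph0_lt : Prop :=
  ∀ (κ : Cardinal.{0}) (hκ : ℵ₀ < κ),
    ∃ (K : Type) (_ : Field K) (_ : CharZero K) (_ : Literature.ModelTheory.ExponentialFields.ExponentialRing K),
      IsZilberField K ∧ #K = κ

/-- OPEN CONJECTURE — **EAC in place of SEAC in Zilber's axioms** (a registered open statement,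
CONVENTIONS §4, not named-fact debt: no `IsZilberField.of_isExpAlgClosed_holds` is to be
expected, and users keep it as an explicit hypothesis). The statement, for an exponential field
`K` of characteristic zero: if `K` is algebraically closed with standard kernel, surjective `exp`,
the Schanuel property, exponential-algebraic closedness (`IsExpAlgClosed K`) and the countable
closure property, then `K` is a Zilber field — i.e., the other five fields of `IsZilberField`
being among the hypotheses, `K` is *strongly* exponentially-algebraically closed. POSED as an
open question (not proved) by J. Kirby, *A note on the axioms for Zilber's pseudo-exponential
fields*, Notre Dame J. Formal Logic 54 (2013) 509–520, §2.3, in the remark after the proof of the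
Proposition: "In [EFAI] we prove that the notions of exponential-algebraic closedness and strong
exponential-algebraic closedness coincide under the additional assumption that the diophantine
conjecture CIT is true (and assuming the other relevant axioms) and it would be interesting to
know if the same result can be proved unconditionally"
[cite: Kirby2013Axioms, §2.3, remark after the Proposition (question posed; open)]. [status: open] —
what is in print: (i) *assuming CIT* it is a theorem, Kirby–Zilber 2014, Thm 1.5 (= Thm 5.7,
"Assuming CIT, the theory ECF is axiomatized by axioms 1, 2′, 3′, and EAC"; standard kernel and
the Schanuel property imply axioms 2′ and 3′: §4.1, Lemma "ECF_SK ⊆ ECF"), in tree as the named fact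
`Literature.NumberTheory.Transcendental.kirbyZilber2014_isStronglyExpAlgClosed_of_isExpAlgClosed`
with the proved corollary `Literature.NumberTheory.Transcendental.IsZilberField.of_isExpAlgClosed_of_cit :
kirbyZilber2014_isStronglyExpAlgClosed_of_isExpAlgClosed K → ConjectureOnIntersectionsWithTori →
IsZilberField.of_isExpAlgClosed` (`IntersectionsWithTori.lean`)
[cite: KirbyZilber2014, Thm 1.5 (= Thm 5.7), the CIT-conditional theorem]; there EAC is axiom 4′,
"every rotund subvariety of `𝔾ₐⁿ × 𝔾ₘⁿ` defined over `F` meets the graph of `exp`", with no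
freeness or dimension-`n` restriction, so formally stronger as a hypothesis than
`IsExpAlgClosed`, and equivalent to it for ELA-fields of infinite transcendence degree by their
Lemma 5.5; (ii) *unconditionally* only the *generic* version is proved — Bays–Kirby 2018,
Prop. 11.5: for a full Γ-field `F` and a closed proper sub-Γ-field `K ◁ F`, `F` is generically
strongly Γ-closed over `K` if and only if it is generically Γ-closed over `K` ("The Schanuel
property is replaced by the assumption that `K` is Γ-closed in `F`, and instead of the
Zilber-Pink conjecture it is enough to use the weak version which is a theorem", §11.1)
[cite: BaysKirby2018ANT, Prop. 11.5 and §1.2 (generic version only)]; (iii) the status is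
unchanged in the 2024 survey of Aslanyan (Model Theory 3, p. 605, after Conjecture 2.7 (SEC)):
"It is obvious that SEC implies EC. The converse is also true assuming SC and CIT hold (see
[Eterović 2022; Kirby and Zilber 2014])", with Remark 2.8: EC gives a Zariski dense set of
exponential points on a free rotund variety, "but a priori such a set may not contain a generic
point" [cite: Aslanyan2024, §2A, after Conjecture 2.7 and Remark 2.8 (p. 605)]. The CCP
hypothesis is carried into the conclusion unchanged (for countable `K` it is vacuous).

History of this declaration: it was first vendored as a "theorem of Kirby 2013", a mis-citation
(Kirby 2013, Thm 1 is "`ℂ_exp ≡ 𝔹` implies `ℂ_exp ≅ 𝔹`"); what Kirby 2013 §2.3 does prove is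
vendored below as `Literature.NumberTheory.Transcendental.kirby2013_isStronglyExpAlgClosed_iff_isLinIndepExpAlgClosed`
(SEAC ⇔ Kirby's linear-independence scheme `Literature.NumberTheory.Transcendental.IsLinIndepExpAlgClosed`,
modulo axioms 1–3), with the corollary `Literature.NumberTheory.Transcendental.IsZilberField.of_isLinIndepExpAlgClosed`.
The name is kept rather than renamed `…Conjecture` (statement unchanged): it is the type of
`IsZilberField.of_isExpAlgClosed_of_cit` and an explicit hypothesis of route items
(`Summits/Schanuel/Schanuel/Theses/Zilber.lean`). -/
@[conjecture] def IsZilberField.of_isExpAlgClosed {K : Type*} [Field K] [CharZero K]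
    [Literature.ModelTheory.ExponentialFields.ExponentialRing K] : Prop :=
  ∀ (hac : IsAlgClosed K) (hker : HasStandardKernel K) (hsurj : Literature.ModelTheory.ExponentialFields.ExponentialRing.IsSurjectiveOntoUnits K) (hSP : Literature.ModelTheory.ExponentialFields.SchanuelProperty K) (hEAC : IsExpAlgClosed K) (hCCP : HasCountableClosureProperty K),
    IsZilberField K

/-- The kernel of the complex exponential is standard *provided* `π` is transcendental:
`ker exp = 2πiℤ` (`Literature.ModelTheory.ExponentialFields.ExponentialRing.mem_expKernel_complex_iff`, from Mathlib's
`Complex.exp_eq_one_iff`) and `2πi` is transcendental since `(2πi)² = -4π²`. The unconditional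
statement (via Lindemann's theorem) lives in the statements layer. Zilber 2005 §1. [cite: Zilber2005, §1] -/
theorem hasStandardKernel_complex_of_transcendental_pi (hπ : Transcendental ℚ Real.pi) :
    HasStandardKernel ℂ := by
  refine ⟨2 * Real.pi * Complex.I, ?_, ?_⟩
  · intro h
    have h2 : IsAlgebraic ℚ ((Real.pi : ℂ) ^ 2) := by
      have hsq : (2 * (Real.pi : ℂ) * Complex.I) ^ 2 * algebraMap ℚ ℂ (-1 / 4) =
          (Real.pi : ℂ) ^ 2 := by
        rw [mul_pow, mul_pow, Complex.I_sq, map_div₀, map_neg, map_one, map_ofNat]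
        ring
      rw [← hsq]
      exact (h.pow 2).mul (isAlgebraic_algebraMap _)
    have hpi : IsAlgebraic ℚ (algebraMap ℝ ℂ Real.pi) := h2.of_pow two_pos
    rw [isAlgebraic_algebraMap_iff (algebraMap ℝ ℂ).injective] at hpi
    exact hπ hpi
  · ext x
    rw [Literature.ModelTheory.ExponentialFields.ExponentialRing.mem_expKernel_complex_iff, AddSubgroup.mem_zmultiples_iff]
    constructor
    · rintro ⟨n, rfl⟩
      exact ⟨n, by rw [zsmul_eq_mul]⟩
    · rintro ⟨n, rfl⟩
      exact ⟨n, by rw [zsmul_eq_mul]⟩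

/-- `ℂ_exp` has the countable closure property (Zilber 2005, Lemma 5.12; Kirby 2010, Thm 1.3:
`ecl` on `ℂ` is contained in a countable-character pregeometry by analytic arguments). [cite: Zilber2005, Lemma 5.12] -/
def hasCountableClosureProperty_complex : Prop :=
  HasCountableClosureProperty ℂ

end Theorems

end Literature.NumberTheory.Transcendental

/-! ### Quasiminimality -/

namespace FirstOrder.Language

/-- An `L`-structure `M` is *quasiminimal* if every subset of `M` definable with parameters from
`M` is countable or co-countable (Zilber 2005 §1 and Thm 1.2; Bays–Kirby 2018 §1).

This is a deliberate dot-notation extension in Mathlib's namespace `FirstOrder.Language`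
(precedent: `FirstOrder.Language.IsOMinimal` in `Literature.Prelude.TranscendEllArithS.ModelTheoryPreds`),
so that one writes `Language.expRing.IsQuasiminimal K`. [cite: Zilber2005, §1 and Thm 1.2] -/
def IsQuasiminimal (L : FirstOrder.Language) (M : Type*) [L.Structure M] : Prop :=
  ∀ s : Set M, (Set.univ : Set M).Definable₁ L s → s.Countable ∨ sᶜ.Countable

variable {L : FirstOrder.Language} {M : Type*} [L.Structure M]

/-- Unfolding lemma for `Language.IsQuasiminimal` (Zilber 2005 §1). [cite: Zilber2005, §1] -/
theorem isQuasiminimal_iff : L.IsQuasiminimal M ↔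
    ∀ s : Set M, (Set.univ : Set M).Definable₁ L s → s.Countable ∨ sᶜ.Countable :=
  Iff.rfl

end FirstOrder.Language

namespace Literature.NumberTheory.Transcendental

/-- **Quasiminimality of Zilber fields** (Zilber 2005, Thm 1.2; Bays–Kirby 2018, Thm 1.3): every
Zilber field is quasiminimal in the language of exponential rings `Literature.ModelTheory.ExponentialFields.Language.expRing` — every
definable subset is countable or co-countable. [cite: Zilber2005, Thm 1.2] -/
def IsZilberField.isQuasiminimal : Prop :=
  ∀ {K : Type*} [Field K] [CharZero K] [Literature.ModelTheory.ExponentialFields.ExponentialRing K] (hK : IsZilberField K),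
    Literature.ModelTheory.ExponentialFields.Language.expRing.IsQuasiminimal K

end Literature.NumberTheory.Transcendental

/-! ### Kirby's linear-independence form of SEAC (Kirby 2013, §2.3) -/

namespace Literature.NumberTheory.Transcendental

section Kirby2013

/-- **Kirby's linear-independence scheme** (Kirby 2013, §2.3, the axiom scheme in the proof of the
Proposition "Axiom 4 (SEAC) is first-order expressible modulo axioms 1, 2, and 3"): for every
irreducible rotund, additively and multiplicatively free subvariety `V = W ∩ Gⁿ` of
`Gⁿ = Kⁿ × (Kˣ)ⁿ` of dimension `n` (presented by its Zariski closure `W`, exactly as in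
`IsStronglyExpAlgClosed`) and every finite tuple `ā` from `K`, there is `x̄` with `(x̄, e^x̄) ∈ V`
such that `∑ mᵢ xᵢ + ∑ m_{n+i} aᵢ = 0` with `m̄ ∈ ℚ^{n+r}` forces `m₁ = ⋯ = mₙ = 0`.
Clearing denominators, Kirby's condition on `m̄ ∈ ℚ^{n+r}` is the same as: no nonzero *integer*
combination `∑ mᵢ xᵢ` lies in the `ℚ`-span of `ā` — the form used here, matching the integer
coefficients of `IsAddFree` (the equivalence with Kirby's literal form is
`forall_intCast_mul_mem_span_iff` below, with `a` an enumeration of `A`). Kirby's scheme carries no "field of definition" clause (every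
subvariety over `K` is a member `V_p` of some parametric family), and neither does this. [cite: Kirby2013, §2.3, proof of the Proposition (axiom scheme)] -/
def IsLinIndepExpAlgClosed (K : Type*) [Field K] [CharZero K]
    [Literature.ModelTheory.ExponentialFields.ExponentialRing K] : Prop :=
  ∀ (n : ℕ) (W : Set (Fin n ⊕ Fin n → K)), IsIrreducibleClosed K W →
    (W ∩ torusLocus K n).Nonempty → IsRotund K n (W ∩ torusLocus K n) →
    IsAddFree K n (W ∩ torusLocus K n) → IsMulFree K n (W ∩ torusLocus K n) →
    zariskiDim K W = n →
    ∀ (A : Finset K), ∃ z ∈ W ∩ expGraph K n,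
      ∀ m : Fin n → ℤ, (∑ i, (m i : K) * z (Sum.inl i)) ∈ Submodule.span ℚ (↑A : Set K) → m = 0

variable {K : Type*} [Field K] [CharZero K] [Literature.ModelTheory.ExponentialFields.ExponentialRing K]

omit [Literature.ModelTheory.ExponentialFields.ExponentialRing K] in
/-- The `ℚ`-span of a subset of a subfield `F ≤ K` (char. 0) lies in `F`. [folklore] -/
theorem span_rat_le_subfield {F : Subfield K} {s : Set K} (hs : s ⊆ F) {c : K}
    (hc : c ∈ Submodule.span ℚ s) : c ∈ F := by
  induction hc using Submodule.span_induction with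
  | mem x hx => exact hs hx
  | zero => exact zero_mem F
  | add x y _ _ hx hy => exact add_mem hx hy
  | smul q x _ hx => exact SubfieldClass.qsmul_mem F q hx

omit [Literature.ModelTheory.ExponentialFields.ExponentialRing K] in
/-- **The side condition of `IsLinIndepExpAlgClosed` is Kirby's literal one** (Kirby 2013, §2.3,
the scheme: `(∀ m̄ ∈ ℚ^{n+r}) (∑ᵢ mᵢxᵢ + ∑ⱼ m_{n+j}aⱼ = 0 → ⋀ᵢ mᵢ = 0)`): "no nonzero integer
combination of `x̄` lies in `span_ℚ ā`" is equivalent to "every `ℚ`-linear relation among `x̄, ā`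
has vanishing `x̄`-coefficients" (clear denominators by `∏ den mᵢ`). [cite: Kirby2013, §2.3, proof of the Proposition (axiom scheme)] -/
theorem forall_intCast_mul_mem_span_iff {n : ℕ} {ι : Type*} [Fintype ι] (x : Fin n → K)
    (a : ι → K) :
    (∀ m : Fin n → ℤ, (∑ i, (m i : K) * x i) ∈ Submodule.span ℚ (Set.range a) → m = 0) ↔
    (∀ (m : Fin n → ℚ) (m' : ι → ℚ), ∑ i, m i • x i + ∑ j, m' j • a j = 0 → m = 0) := by
  classical
  have hzq : ∀ (z : ℤ) (y : K), ((z : ℚ) • y) = (z : K) * y := fun z y => by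
    rw [Int.cast_smul_eq_zsmul, zsmul_eq_mul]
  constructor
  · intro h m m' hmm'
    have hS : ∑ i, m i • x i ∈ Submodule.span ℚ (Set.range a) := by
      rw [eq_neg_of_add_eq_zero_left hmm']
      exact Submodule.neg_mem _ (Submodule.sum_mem _ fun j _ =>
        Submodule.smul_mem _ _ (Submodule.subset_span ⟨j, rfl⟩))
    set d : ℕ := ∏ i, (m i).den with hd
    have hd0 : d ≠ 0 := Finset.prod_ne_zero_iff.mpr fun i _ => (m i).den_nz
    have hk : ∀ i, ∃ k : ℤ, (k : ℚ) = d * m i := by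
      intro i
      refine ⟨(∏ j ∈ Finset.univ.erase i, ((m j).den : ℤ)) * (m i).num, ?_⟩
      rw [hd, ← Finset.prod_erase_mul _ _ (Finset.mem_univ i)]
      push_cast
      rw [mul_assoc, ← Rat.mul_den_eq_num, mul_comm (m i)]
    choose k hk using hk
    have hmem : ∑ i, (k i : K) * x i ∈ Submodule.span ℚ (Set.range a) := by
      have : ∑ i, (k i : K) * x i = (d : ℚ) • ∑ i, m i • x i := by
        rw [Finset.smul_sum]
        refine Finset.sum_congr rfl fun i _ => ?_
        rw [smul_smul, ← hk i, hzq]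
      rw [this]
      exact Submodule.smul_mem _ _ hS
    have hk0 := h k hmem
    ext i
    have hi : (d : ℚ) * m i = 0 := by rw [← hk i, hk0, Pi.zero_apply, Int.cast_zero]
    exact (mul_eq_zero.mp hi).resolve_left (Nat.cast_ne_zero.mpr hd0)
  · intro h m hm
    obtain ⟨c, hc⟩ := (Submodule.mem_span_range_iff_exists_fun ℚ).mp hm
    have h0 := h (fun i => (m i : ℚ)) (fun j => -c j) (by
      simp only [neg_smul, Finset.sum_neg_distrib, hc, hzq]
      exact add_neg_cancel _)
    ext i
    have hi : ((m i : ℚ)) = 0 := congr_fun h0 i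
    exact_mod_cast hi

/-- **SEAC implies Kirby's scheme** (Kirby 2013, §2.3, proof of the Proposition: "It also
follows from axiom 4, since that axiom gives an `x̄` such that `(x̄, e^x̄)` is generic in `V_p` over
`ā`. Since `V_p` is additively free, that `x̄` does not satisfy any `ℚ`-linear equation over `ā`").
Proof: if `∑ mᵢ zᵢ = c ∈ span_ℚ ā ⊆ F := ℚ(ā ∪ F₀)`, the polynomial `∑ mᵢ Xᵢ − c ∈ F[X, Y]`
vanishes at the `F`-generic point `z`, hence on `W`, contradicting additive freeness of
`W ∩ Gⁿ`. [cite: Kirby2013, §2.3, proof of the Proposition] -/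
theorem IsStronglyExpAlgClosed.isLinIndepExpAlgClosed (h : IsStronglyExpAlgClosed K) :
    IsLinIndepExpAlgClosed K := by
  classical
  intro n W hirr hne hrot hadd hmul hdim A
  obtain ⟨F₀, hF₀⟩ := hirr.1.exists_isDefinedOver
  obtain ⟨z, hz, hgen⟩ := h n W hirr hne hrot hadd hmul hdim A F₀ hF₀
  refine ⟨z, hz, fun m hm => ?_⟩
  by_contra hm0
  set F : Subfield K := Subfield.closure (↑A ∪ ↑F₀ : Set K) with hF
  set c : K := ∑ i, (m i : K) * z (Sum.inl i) with hc
  have hcF : c ∈ F :=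
    span_rat_le_subfield (fun a ha => Subfield.subset_closure (Or.inl ha)) hm
  -- the linear polynomial `∑ mᵢ Xᵢ - c` with coefficients in `F`
  set p : MvPolynomial (Fin n ⊕ Fin n) F :=
    ∑ i, C ((m i : ℤ) : F) * X (Sum.inl i) - C ⟨c, hcF⟩ with hp
  have hpeval : ∀ w : Fin n ⊕ Fin n → K,
      aeval w p = ∑ i, (m i : K) * w (Sum.inl i) - c := by
    intro w
    simp only [hp, map_sub, map_sum, map_mul, aeval_C, aeval_X, map_intCast]
    rfl
  have hpz : p ∈ MvPolynomial.vanishingIdeal F ({z} : Set (Fin n ⊕ Fin n → K)) := by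
    rw [MvPolynomial.mem_vanishingIdeal_iff]
    rintro w rfl
    rw [hpeval, hc, sub_self]
  rw [hgen.2, MvPolynomial.mem_vanishingIdeal_iff] at hpz
  refine hadd m hm0 ⟨c, fun w hw => ?_⟩
  have := hpz w hw.1
  rwa [hpeval, sub_eq_zero] at this

/-- **Kirby's scheme implies EAC** (take the parameter tuple `ā` empty): the scheme sits between
SEAC and EAC, `IsStronglyExpAlgClosed K → IsLinIndepExpAlgClosed K → IsExpAlgClosed K`, so routes
may replace an EAC hypothesis by the scheme uniformly. Kirby 2013, §2.3. [cite: Kirby2013, §2.3, proof of the Proposition (axiom scheme)] -/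
theorem IsLinIndepExpAlgClosed.isExpAlgClosed (h : IsLinIndepExpAlgClosed K) :
    IsExpAlgClosed K := by
  intro n W hirr hne hrot hadd hmul hdim
  obtain ⟨z, hz, -⟩ := h n W hirr hne hrot hadd hmul hdim ∅
  exact ⟨z, hz⟩

/-- **Kirby 2013, §2.3, Proposition** (SEAC is first-order modulo axioms 1–3; mathematical
content of the proof: "Thus axiom 4 is equivalent to this scheme, modulo axioms 1, 2, and 3"): for
an ELA-field `K` (algebraically closed of characteristic zero with surjective `exp`) with standard
kernel and the Schanuel property, strong exponential-algebraic closedness is equivalent to Kirby's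
linear-independence scheme `IsLinIndepExpAlgClosed K`. The direction SEAC ⇒ scheme is
`IsStronglyExpAlgClosed.isLinIndepExpAlgClosed` (proved, unconditionally); the converse uses the
Schanuel property: extend `ā` to a strong tuple over which `V` is defined, then
`ldim_ℚ(x̄/ā) = n` forces `td(x̄, e^x̄/ā, e^ā) ≥ n = dim V`, i.e. genericity.

This is the corrected form of the mis-cited `IsZilberField.of_isExpAlgClosed` (same source):
Kirby 2013 does not weaken SEAC to EAC. [cite: Kirby2013, §2.3, Proposition and its proof] -/
def kirby2013_isStronglyExpAlgClosed_iff_isLinIndepExpAlgClosed (K : Type*) [Field K] [CharZero K]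
    [Literature.ModelTheory.ExponentialFields.ExponentialRing K] : Prop :=
  IsAlgClosed K → Literature.ModelTheory.ExponentialFields.ExponentialRing.IsSurjectiveOntoUnits K → HasStandardKernel K →
    Literature.ModelTheory.ExponentialFields.SchanuelProperty K → (IsStronglyExpAlgClosed K ↔ IsLinIndepExpAlgClosed K)

/-- **Zilber field from Kirby's scheme** (corollary of Kirby 2013, §2.3, Proposition): given
Kirby's equivalence, an algebraically closed exponential field of characteristic zero with standard
kernel, surjective `exp`, the Schanuel property, Kirby's linear-independence scheme and CCP is a
Zilber field. This is the usable replacement of `IsZilberField.of_isExpAlgClosed` for routes: the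
existence half of SEAC may be verified in the weaker "`ℚ`-linearly independent over `ā`" form
instead of full genericity. [cite: Kirby2013, §2.3, Proposition] -/
theorem IsZilberField.of_isLinIndepExpAlgClosed
    (h : kirby2013_isStronglyExpAlgClosed_iff_isLinIndepExpAlgClosed K)
    (hac : IsAlgClosed K) (hker : HasStandardKernel K)
    (hsurj : Literature.ModelTheory.ExponentialFields.ExponentialRing.IsSurjectiveOntoUnits K) (hSP : Literature.ModelTheory.ExponentialFields.SchanuelProperty K)
    (hLI : IsLinIndepExpAlgClosed K) (hCCP : HasCountableClosureProperty K) :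
    IsZilberField K where
  isAlgClosed := hac
  hasStandardKernel := hker
  isSurjectiveOntoUnits := hsurj
  schanuelProperty := hSP
  isStronglyExpAlgClosed := (h hac hsurj hker hSP).mpr hLI
  hasCountableClosureProperty := hCCP

/-- Conversely every Zilber field satisfies Kirby's scheme (unconditionally, from SEAC). [cite: Kirby2013, §2.3, proof of the Proposition] -/
theorem IsZilberField.isLinIndepExpAlgClosed (hK : IsZilberField K) : IsLinIndepExpAlgClosed K :=
  hK.isStronglyExpAlgClosed.isLinIndepExpAlgClosed

end Kirby2013

end Literature.NumberTheory.Transcendental
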